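import Literature.AlgebraicGeometry.Motives.HodgeLieRigidModuloCentre
import Literature.AlgebraicGeometry.Motives.HodgeLieProductSimpleFactor
import HarnessLib

/-!
# The restriction `𝔥(H) → 𝔥(H₁)`, `X ↦ π X ι`, to a direct summand of a polarizable Hodge structure is onto MODULO THE CENTRE:
# its image contains `[𝔥(H₁), 𝔥(H₁)]`, and `𝔥(H₁) = π 𝔥(H) ι + 𝔷(H₁)` (Moonen–Zarhin (3.1) «the projections are surjective», semisimple part)

Family `hodge`, layer `Literature/AlgebraicGeometry/Motives`.  THEOREMS ONLY (no definition, no named fact).  Written for the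
cell `pub-hodgecm2` (COR-CM), seat `b27` gen 54 (count-neutral Mumford–Tate-rank ladder, «rigidity modulo the centre», part 5).

For a retract `ι : H₁ → H`, `π : H → H₁`, `π ι = id`, of pure `ℚ`-Hodge structures (`H₁` polarized), the restriction
`r : X ↦ π X ι` maps `𝔥(H)` into `𝔥(H₁)` (`Motives/HodgeLieDirectSum`), onto a bracket-closed subspace whose complex span contains the
Hodge operator `π Θ_H ι` of `H₁` (`Motives/HodgeLieBlockSummandSurjective`, `Motives/HodgeLieProductSimpleFactor`).  The tree proved
`r(𝔥(H)) = 𝔥(H₁)` under `Θ`-RIGIDITY of `H₁`.  By «rigidity modulo the centre» (`Motives/HodgeLieRigidModuloCentre`, gen 54) we get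
for EVERY polarized `H₁`:
* **`hodgeLie_derived_le_map_restrict`** — `[𝔥(H₁), 𝔥(H₁)] ⊆ r(𝔥(H))`;
* **`hodgeLie_le_map_restrict_sup_center`** — `𝔥(H₁) ⊆ r(𝔥(H)) + 𝔷(𝔥(H₁))`, `𝔷(𝔥(H₁)) = 𝔥(H₁) ∩ End_Hdg(H₁)`;
* **`finrank_hodgeLie_le_add_finrank_center_of_retract`** — `dim 𝔥(H₁) ≤ dim 𝔥(H) + dim 𝔷(𝔥(H₁))`;
* **`hodgeLie_eq_map_restrict_of_center_eq_bot`** — `𝔷(𝔥(H₁)) = 0 ⟹ r(𝔥(H)) = 𝔥(H₁)` and `dim 𝔥(H₁) ≤ dim 𝔥(H)`.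

## References
* [MoonenZarhin1999LowDim] B. Moonen, Yu. G. Zarhin, Math. Ann. 315 (1999), §3 (3.1) [corpus: paper:arxiv-math_9901113 p. 6].
  [cite: MoonenZarhin1999LowDim, §3 (3.1)]
* [Deligne1982HodgeCycles] P. Deligne, LNM 900 (1982), I §3.1, Prop. 3.4, Prop. 3.6. [cite: Deligne1982HodgeCycles, I §3 Prop. 3.6]
-/

noncomputable section

namespace Literature.AlgebraicGeometry.Motives

namespace HodgeStructure

universe u

variable {V₁ : Type u} [AddCommGroup V₁] [Module ℚ V₁] [Module.Finite ℚ V₁]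
  {V : Type u} [AddCommGroup V] [Module ℚ V] [Module.Finite ℚ V] [HodgeTensorFacts.{u, u}] {n : ℤ}
  {H₁ : HodgeStructure V₁ n} {H : HodgeStructure V n}

variable (ι : Hom H₁ H) (π : Hom H H₁) (hπι : ∀ v, π.toLinearMap (ι.toLinearMap v) = v)

include hπι in
/-- The image `r(𝔥(H))` of the restriction is a `Θ`-subalgebra of `𝔥(H₁)`: contained in `𝔥(H₁)`, bracket-closed, with a Hodge operator of
`H₁` in its complex span. [cite: MoonenZarhin1999LowDim, §3 (3.1)] [cite: Deligne1982HodgeCycles, I §3 Prop. 3.6] -/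
theorem map_restrict_theta_subalgebra :
    H.hodgeLie.map ((LinearMap.llcomp ℚ V₁ V V₁ π.toLinearMap).comp (LinearMap.lcomp ℚ V ι.toLinearMap)) ≤ H₁.hodgeLie ∧
      (∀ X ∈ H.hodgeLie.map ((LinearMap.llcomp ℚ V₁ V V₁ π.toLinearMap).comp (LinearMap.lcomp ℚ V ι.toLinearMap)),
        ∀ Y ∈ H.hodgeLie.map ((LinearMap.llcomp ℚ V₁ V V₁ π.toLinearMap).comp (LinearMap.lcomp ℚ V ι.toLinearMap)),
          X * Y - Y * X ∈ H.hodgeLie.map ((LinearMap.llcomp ℚ V₁ V V₁ π.toLinearMap).comp (LinearMap.lcomp ℚ V ι.toLinearMap))) ∧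
      ∃ Θ ∈ Submodule.span ℂ ((fun X : Module.End ℚ V₁ => X.baseChange ℂ) ''
          ((H.hodgeLie.map ((LinearMap.llcomp ℚ V₁ V V₁ π.toLinearMap).comp (LinearMap.lcomp ℚ V ι.toLinearMap)) :
            Submodule ℚ (Module.End ℚ V₁)) : Set (Module.End ℚ V₁))),
        ∀ p, ∀ x ∈ H₁.piece p (n - p), Θ x = ((2 * p - n : ℤ) : ℂ) • x := by
  set r := (LinearMap.llcomp ℚ V₁ V V₁ π.toLinearMap).comp (LinearMap.lcomp ℚ V ι.toLinearMap) with hr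
  have hr_apply : ∀ X : Module.End ℚ V, r X = π.toLinearMap ∘ₗ X ∘ₗ ι.toLinearMap := fun X => rfl
  refine ⟨?_, ?_, ?_⟩
  · rintro _ ⟨X, hX, rfl⟩
    rw [hr_apply]
    exact comp_mem_hodgeLie_of_retract ι π hπι hX
  · rintro _ ⟨X, hX, rfl⟩ _ ⟨Y, hY, rfl⟩
    refine ⟨X * Y - Y * X, H.commutator_mem_hodgeLie hX hY, ?_⟩
    rw [hr_apply, hr_apply, hr_apply, ← restrict_mul ι π hπι hY, ← restrict_mul ι π hπι hX]
    refine LinearMap.ext fun v => ?_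
    simp only [LinearMap.comp_apply, LinearMap.sub_apply, Module.End.mul_apply, map_sub]
  · obtain ⟨Θ, hΘmem, hΘ⟩ := exists_theta_mem_span_restrict ι π hπι
    refine ⟨Θ, ?_, hΘ⟩
    have hset : ((fun X : Module.End ℚ V => π.toLinearMap ∘ₗ X ∘ₗ ι.toLinearMap) '' (H.hodgeLie : Set (Module.End ℚ V))) =
        ((H.hodgeLie.map r : Submodule ℚ (Module.End ℚ V₁)) : Set (Module.End ℚ V₁)) := by
      rw [Submodule.map_coe]
      exact Set.image_congr fun X _ => (hr_apply X).symm
    rw [← hset]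
    exact hΘmem

include hπι in
/-- **`[𝔥(H₁), 𝔥(H₁)] ⊆ π 𝔥(H) ι`** for every retract `H₁` of `H` with `H₁` polarized: the restriction to a direct summand is onto the
derived algebra (`derived_le_of_theta_mem` applied to the `Θ`-subalgebra `r(𝔥(H))`). [cite: MoonenZarhin1999LowDim, §3 (3.1)]
[cite: Deligne1982HodgeCycles, I §3 Prop. 3.6] -/
theorem hodgeLie_derived_le_map_restrict (ψ₁ : H₁.Polarization) :
    Submodule.span ℚ {B | ∃ X ∈ H₁.hodgeLie, ∃ Y ∈ H₁.hodgeLie, X * Y - Y * X = B} ≤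
      H.hodgeLie.map ((LinearMap.llcomp ℚ V₁ V V₁ π.toLinearMap).comp (LinearMap.lcomp ℚ V ι.toLinearMap)) := by
  obtain ⟨hle, hbr, hΘ⟩ := map_restrict_theta_subalgebra ι π hπι
  exact derived_le_of_theta_mem H₁ ψ₁ _ hle hbr hΘ

include hπι in
/-- **`𝔥(H₁) ⊆ π 𝔥(H) ι + 𝔷(𝔥(H₁))`**: the restriction to a polarized direct summand is onto modulo the centre `𝔥(H₁) ∩ End_Hdg(H₁)`.
[cite: MoonenZarhin1999LowDim, §3 (3.1)] [cite: Deligne1982HodgeCycles, I §3 Prop. 3.6] -/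
theorem hodgeLie_le_map_restrict_sup_center (ψ₁ : H₁.Polarization) :
    H₁.hodgeLie ≤ H.hodgeLie.map ((LinearMap.llcomp ℚ V₁ V V₁ π.toLinearMap).comp (LinearMap.lcomp ℚ V ι.toLinearMap)) ⊔
      H₁.hodgeLie ⊓ Subalgebra.toSubmodule H₁.endAlg := by
  obtain ⟨hle, hbr, hΘ⟩ := map_restrict_theta_subalgebra ι π hπι
  exact hodgeLie_le_sup_center_of_theta_mem H₁ ψ₁ _ hle hbr hΘ

include hπι in
/-- **`dim 𝔥(H₁) ≤ dim 𝔥(H) + dim 𝔷(𝔥(H₁))`** for a polarized retract `H₁` of `H`. [cite: MoonenZarhin1999LowDim, §3 (3.1)] -/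
theorem finrank_hodgeLie_le_add_finrank_center_of_retract (ψ₁ : H₁.Polarization) :
    Module.finrank ℚ H₁.hodgeLie ≤ Module.finrank ℚ H.hodgeLie + Module.finrank ℚ ↥(H₁.hodgeLie ⊓ Subalgebra.toSubmodule H₁.endAlg) := by
  have h := Submodule.finrank_mono (hodgeLie_le_map_restrict_sup_center ι π hπι ψ₁)
  refine h.trans ((Submodule.finrank_add_le_finrank_add_finrank _ _).trans ?_)
  exact Nat.add_le_add_right (Submodule.finrank_map_le _ _) _

include hπι in
/-- **Centre-free summands: `𝔷(𝔥(H₁)) = 0 ⟹ π 𝔥(H) ι = 𝔥(H₁)`** (Moonen–Zarhin's surjectivity of the projection, for every polarized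
summand with centre-free Hodge Lie algebra — e.g. `H¹` of an abelian variety without factors of type IV). [cite: MoonenZarhin1999LowDim, §3 (3.1)] -/
theorem hodgeLie_eq_map_restrict_of_center_eq_bot (ψ₁ : H₁.Polarization) (h𝔷 : H₁.hodgeLie ⊓ Subalgebra.toSubmodule H₁.endAlg = ⊥) :
    H₁.hodgeLie = H.hodgeLie.map ((LinearMap.llcomp ℚ V₁ V V₁ π.toLinearMap).comp (LinearMap.lcomp ℚ V ι.toLinearMap)) := by
  obtain ⟨hle, -, -⟩ := map_restrict_theta_subalgebra ι π hπι
  refine le_antisymm ?_ hle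
  have h := hodgeLie_le_map_restrict_sup_center ι π hπι ψ₁
  rwa [h𝔷, sup_bot_eq] at h

include hπι in
/-- `dim 𝔥(H₁) ≤ dim 𝔥(H)` for a polarized retract with centre-free `𝔥(H₁)`. [cite: MoonenZarhin1999LowDim, §3 (3.1)] -/
theorem finrank_hodgeLie_le_of_retract_of_center_eq_bot (ψ₁ : H₁.Polarization)
    (h𝔷 : H₁.hodgeLie ⊓ Subalgebra.toSubmodule H₁.endAlg = ⊥) :
    Module.finrank ℚ H₁.hodgeLie ≤ Module.finrank ℚ H.hodgeLie := by
  have h := finrank_hodgeLie_le_add_finrank_center_of_retract ι π hπι ψ₁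
  rw [h𝔷, finrank_bot, add_zero] at h
  exact h

end HodgeStructure

end Literature.AlgebraicGeometry.Motives

end
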